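import Mathlib
import Literature.Analysis.FluidPDE.VectorCalculus
import Summits.NavierStokesRegularity.NavierStokesRegularity.Theorems.UnthreadedDoorFluxStarvedDipoleLatitudeFlux
import Summits.NavierStokesRegularity.NavierStokesRegularity.Theorems.UnthreadedDoorFluxStarvedDipoleLatitudeModeTools
import HarnessLib

/-!
# Route `UnthreadedDoor`, crux `PoloidalLiouville` (stmt-NavierStokesRegularity-1222), wall W1 — crux idea
# «flux-starved-dipoles»: ALL LATITUDE FOURIER MODES OF A TANGENT, SOLENOIDAL, UNTHREADED FIELD VANISH
# (third brick of L0 `SphereTangentUnthreadedVanishes`: L0 up to Fourier uniqueness on the circle)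

In the moving frame of an axis `n` the tangential components `(u_θ, u_φ)` of a `C¹` field which is divergence-free, tangent to the
spheres of a shell about `x₀` and unthreaded on `S_r(x₀)` satisfy `∂_θ(sin θ·u_φ) = ∂_φ u_θ` (p838833) and
`∂_θ(sin θ·u_θ) = −∂_φ u_φ` (p838877) (`latitude_CR_of_unthreaded`, `latitude_CR_of_tangent_divFree`).  Pairing with `cos kφ`,
`sin kφ` (`k ≥ 1`) and integrating by parts, the modes `A_c = ∮ cos kφ·u_φ`, `A_s`, `B_c = ∮ cos kφ·u_θ`, `B_s` obey
`(sin θ A_c)′ = k B_s`, `(sin θ B_s)′ = k A_c`, `(sin θ A_s)′ = −k B_c`, `(sin θ B_c)′ = −k A_s`; so `sin²θ·A_c B_s` and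
`−sin²θ·A_s B_c` have derivative `k sin θ·(sum of squares) ≥ 0` on `[0, π]` and vanish at `0, π`, hence are flat
(`deriv_eq_zero_of_monotone_pinned`): ★ `latitudeModes_eq_zero` — every mode `k ≥ 1` of `u_θ`, `u_φ` on every non-polar
latitude circle vanishes (the modes `k = 0` are p838833/p838877).  An elementary MONOTONICITY substitute for `H¹(S²) = 0`, with no
second derivatives of `u`; tools: `hasDerivAt_intervalIntegral_of_continuous` (differentiation under `∫₀^{2π}`),
`integral_cos_mul_deriv_periodic` / `integral_sin_mul_deriv_periodic` (periodic integration by parts).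

What L0 still needs: Fourier uniqueness on the circle (Mathlib `has_pointwise_sum_fourier_series_of_summable` on `AddCircle`) to
conclude `u_θ = u_φ = 0`, hence `u = 0` on the shell [S/M glue].  HONEST LABEL: kinematics of the tangent/unthreaded class
(information-grade for W1, movement 0); L0, C2, K1′, `PoloidalLiouville` (1222), its wall `stub_scalarLiouville` and the summit stay
OPEN; NO Navier–Stokes regularity statement is proved.  `--supports stmt-NavierStokesRegularity-1222` (helper).  [folklore]
-/

noncomputable section

-- the summit and its single sub-problem share the name (CONVENTIONS §1)
set_option linter.dupNamespace false

open Set Filter Topology InnerProductSpace MeasureTheory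
open scoped RealInnerProductSpace
open Literature.Analysis.FluidPDE
open Summit.NavierStokesRegularity.NavierStokesRegularity.Theorems.PoloidalLiouville.HorizonTower (E3)
open Summit.NavierStokesRegularity.NavierStokesRegularity.Theorems.PoloidalLiouville.KinematicShadow (PointSource.cross_smul_right
  PointSource.cross_add_right PointSource.cross_self PointSource.cross_anticomm)

namespace Summit.NavierStokesRegularity.NavierStokesRegularity.Theorems.PoloidalLiouville.FluxStarvedDipole

/-! ### The Cauchy–Riemann-type system on a sphere of the shell -/

/-- **`∂_θ(sin θ·u_φ) = ∂_φ u_θ` on an unthreaded sphere**: for `u ∈ C¹` unthreaded on `S_r(x₀)` (`r > 0`), along the latitude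
circle of colatitude `θ` of the frame `(n, e, n × e)` the `φ`-derivative of `u_θ` equals the `θ`-derivative of `sin θ·u_φ`
(`radialVorticity_movingFrame`, p838833). [folklore] -/
theorem latitude_CR_of_unthreaded {u : E3 → E3} (hu : ContDiff ℝ 1 u) (x₀ : E3) {r : ℝ} (hr : 0 < r)
    (hunthr : ∀ y : E3, ‖y‖ = r → ⟪y, curl u (x₀ + y)⟫ = 0) {n e : E3} (hn : ‖n‖ = 1) (he : ‖e‖ = 1)
    (hne : ⟪n, e⟫ = 0) (θ φ : ℝ) :
    HasDerivAt (fun φ : ℝ => ⟪u (x₀ + (r * Real.cos θ) • n + (r * Real.sin θ) • (Real.cos φ • e + Real.sin φ • cross n e)), ((-Real.sin θ) • n + Real.cos θ • (Real.cos φ • e + Real.sin φ • cross n e))⟫) (Real.cos θ * ⟪u (x₀ + (r * Real.cos θ) • n + (r * Real.sin θ) • (Real.cos φ • e + Real.sin φ • cross n e)), ((-Real.sin φ) • e + Real.cos φ • cross n e)⟫ + Real.sin θ * ⟪fderiv ℝ u (x₀ + (r * Real.cos θ) • n + (r * Real.sin θ) • (Real.cos φ • e + Real.sin φ • cross n e))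 (r • ((-Real.sin θ) • n + Real.cos θ • (Real.cos φ • e + Real.sin φ • cross n e))), ((-Real.sin φ) • e + Real.cos φ • cross n e)⟫) φ := by
  obtain ⟨hf1, hfn, hfe, hnf, -⟩ := pairFrame_facts hn he hne
  have hnf' : ⟪n, cross n e⟫ = 0 := by rw [real_inner_comm]; exact hfn
  have hef' : ⟪e, cross n e⟫ = 0 := by rw [real_inner_comm]; exact hfe
  have hρ1 : ‖(Real.cos φ • e + Real.sin φ • cross n e)‖ = 1 := (movingFrame_facts he hf1 hef' (Real.cos_sq_add_sin_sq φ)).1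
  have hnρ : ⟪n, (Real.cos φ • e + Real.sin φ • cross n e)⟫ = 0 := by
    rw [inner_add_right, inner_smul_right, inner_smul_right, hne, hnf', mul_zero, mul_zero, add_zero]
  have hnρx : cross n (Real.cos φ • e + Real.sin φ • cross n e) = ((-Real.sin φ) • e + Real.cos φ • cross n e) := by
    rw [PointSource.cross_add_right, PointSource.cross_smul_right, PointSource.cross_smul_right, hnf]
    module
  refine (hasDerivAt_meridional_latitude hu x₀ n e r θ φ).congr_deriv ?_
  have hV := radialVorticity_movingFrame u (x₀ + (r * Real.cos θ) • n + (r * Real.sin θ) • (Real.cos φ • e + Real.sin φ • cross n e)) hn hρ1 hnρ r θ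
  rw [hnρx] at hV
  have hy : (r * Real.cos θ) • n + (r * Real.sin θ) • (Real.cos φ • e + Real.sin φ • cross n e) = r • (Real.cos θ • n + Real.sin θ • (Real.cos φ • e + Real.sin φ • cross n e)) := by module
  have hnorm : ‖(r * Real.cos θ) • n + (r * Real.sin θ) • (Real.cos φ • e + Real.sin φ • cross n e)‖ = r := by
    rw [hy, norm_smul, (movingFrame_facts hn hρ1 hnρ (Real.cos_sq_add_sin_sq θ)).1, mul_one, Real.norm_of_nonneg hr.le]
  have h0 := hunthr _ hnorm
  rw [← add_assoc, hy, real_inner_smul_left, real_inner_comm] at h0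
  have key : r * Real.sin θ * ⟪curl u (x₀ + (r * Real.cos θ) • n + (r * Real.sin θ) • (Real.cos φ • e + Real.sin φ • cross n e)), (Real.cos θ • n + Real.sin θ • (Real.cos φ • e + Real.sin φ • cross n e))⟫ = 0 := by
    calc _ = Real.sin θ * (r * ⟪curl u (x₀ + (r * Real.cos θ) • n + (r * Real.sin θ) • (Real.cos φ • e + Real.sin φ • cross n e)), (Real.cos θ • n + Real.sin θ • (Real.cos φ • e + Real.sin φ • cross n e))⟫) := by ring
      _ = 0 := by rw [h0, mul_zero]
  rw [key] at hV
  linarith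

/-- **`∂_θ(sin θ·u_θ) = −∂_φ u_φ` on a sphere of tangency**: for `u ∈ C¹` divergence-free and tangent to the spheres `S_s(x₀)`,
`r₁ < s < r₂`, on `S_r(x₀)` (`r₁ < r < r₂`) the `φ`-derivative of `u_φ` is minus the `θ`-derivative of `sin θ·u_θ`
(`surfaceDivergence_movingFrame`, p838877; tangency kills `u_ξ` and the radial strain). [folklore] -/
theorem latitude_CR_of_tangent_divFree {u : E3 → E3} (hu : ContDiff ℝ 1 u)
    (hdiv : Literature.Analysis.FluidPDE.VectorCalculus.IsDivFree u) (x₀ : E3) {r₁ r₂ r : ℝ} (hr₁ : 0 ≤ r₁)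
    (h₁ : r₁ < r) (h₂ : r < r₂) (htan : ∀ x : E3, r₁ < ‖x - x₀‖ → ‖x - x₀‖ < r₂ → ⟪u x, x - x₀⟫ = 0)
    {n e : E3} (hn : ‖n‖ = 1) (he : ‖e‖ = 1) (hne : ⟪n, e⟫ = 0) (θ φ : ℝ) :
    HasDerivAt (fun φ : ℝ => ⟪u (x₀ + (r * Real.cos θ) • n + (r * Real.sin θ) • (Real.cos φ • e + Real.sin φ • cross n e)), ((-Real.sin φ) • e + Real.cos φ • cross n e)⟫) (-(Real.cos θ * ⟪u (x₀ + (r * Real.cos θ) • n + (r * Real.sin θ) • (Real.cos φ • e + Real.sin φ • cross n e)), ((-Real.sin θ) • n + Real.cos θ • (Real.cos φ • e + Real.sin φ • cross n e))⟫ + Real.sin θ * (⟪u (x₀ + (r * Real.cos θ) • n + (r * Real.sin θ) • (Real.cos φ • e + Real.sin φ • cross n e)), -(Real.cos θ • n + Real.sin θ • (Real.cos φ • e + Real.sin φ • cross n e))⟫ + ⟪fderiv ℝ u (x₀ + (r * Real.cos θ) • n + (r * Real.sin θ) • (Real.cos φ • e + Real.sin φ • cross n e)) (r • ((-Real.sin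 θ) • n + Real.cos θ • (Real.cos φ • e + Real.sin φ • cross n e))), ((-Real.sin θ) • n + Real.cos θ • (Real.cos φ • e + Real.sin φ • cross n e))⟫))) φ := by
  have hr : 0 < r := lt_of_le_of_lt hr₁ h₁
  obtain ⟨hf1, hfn, hfe, hnf, -⟩ := pairFrame_facts hn he hne
  have hnf' : ⟪n, cross n e⟫ = 0 := by rw [real_inner_comm]; exact hfn
  have hef' : ⟪e, cross n e⟫ = 0 := by rw [real_inner_comm]; exact hfe
  have hρ1 : ‖(Real.cos φ • e + Real.sin φ • cross n e)‖ = 1 := (movingFrame_facts he hf1 hef' (Real.cos_sq_add_sin_sq φ)).1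
  have hnρ : ⟪n, (Real.cos φ • e + Real.sin φ • cross n e)⟫ = 0 := by
    rw [inner_add_right, inner_smul_right, inner_smul_right, hne, hnf', mul_zero, mul_zero, add_zero]
  have hnρx : cross n (Real.cos φ • e + Real.sin φ • cross n e) = ((-Real.sin φ) • e + Real.cos φ • cross n e) := by
    rw [PointSource.cross_add_right, PointSource.cross_smul_right, PointSource.cross_smul_right, hnf]
    module
  -- tangency on the open shell at the point
  have hy : (r * Real.cos θ) • n + (r * Real.sin θ) • (Real.cos φ • e + Real.sin φ • cross n e) = r • (Real.cos θ • n + Real.sin θ • (Real.cos φ • e + Real.sin φ • cross n e)) := by module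
  have hξ1 := (movingFrame_facts hn hρ1 hnρ (Real.cos_sq_add_sin_sq θ)).1
  have hnorm : ‖(r * Real.cos θ) • n + (r * Real.sin θ) • (Real.cos φ • e + Real.sin φ • cross n e)‖ = r := by
    rw [hy, norm_smul, hξ1, mul_one, Real.norm_of_nonneg hr.le]
  have hO : IsOpen {z : E3 | r₁ < ‖z - x₀‖ ∧ ‖z - x₀‖ < r₂} := by
    have hc : Continuous fun z : E3 => ‖z - x₀‖ := continuous_norm.comp (continuous_id.sub continuous_const)
    exact (isOpen_lt continuous_const hc).inter (isOpen_lt hc continuous_const)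
  have hmem : x₀ + (r * Real.cos θ) • n + (r * Real.sin θ) • (Real.cos φ • e + Real.sin φ • cross n e) ∈ {z : E3 | r₁ < ‖z - x₀‖ ∧ ‖z - x₀‖ < r₂} := by
    have hsub' : (x₀ + (r * Real.cos θ) • n + (r * Real.sin θ) • (Real.cos φ • e + Real.sin φ • cross n e)) - x₀
        = (r * Real.cos θ) • n + (r * Real.sin θ) • (Real.cos φ • e + Real.sin φ • cross n e) := by abel
    simp only [mem_setOf_eq, hsub', hnorm]; exact ⟨h₁, h₂⟩
  have hev : (fun z => ⟪u z, z - x₀⟫) =ᶠ[𝓝 (x₀ + (r * Real.cos θ) • n + (r * Real.sin θ) • (Real.cos φ • e + Real.sin φ • cross n e))] fun _ => (0 : ℝ) := by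
    filter_upwards [hO.mem_nhds hmem] with z hz
    exact htan z hz.1 hz.2
  have hsub : (x₀ + (r * Real.cos θ) • n + (r * Real.sin θ) • (Real.cos φ • e + Real.sin φ • cross n e)) - x₀ = (r * Real.cos θ) • n + (r * Real.sin θ) • (Real.cos φ • e + Real.sin φ • cross n e) := by abel
  have hU0 : ⟪u (x₀ + (r * Real.cos θ) • n + (r * Real.sin θ) • (Real.cos φ • e + Real.sin φ • cross n e)), (Real.cos θ • n + Real.sin θ • (Real.cos φ • e + Real.sin φ • cross n e))⟫ = 0 := by
    have h := htan _ hmem.1 hmem.2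
    rw [hsub, hy, inner_smul_right] at h
    rcases mul_eq_zero.mp h with h' | h'
    · exact absurd h' hr.ne'
    · exact h'
  have hS0 : r * ⟪(Real.cos θ • n + Real.sin θ • (Real.cos φ • e + Real.sin φ • cross n e)), fderiv ℝ u (x₀ + (r * Real.cos θ) • n + (r * Real.sin θ) • (Real.cos φ • e + Real.sin φ • cross n e)) (Real.cos θ • n + Real.sin θ • (Real.cos φ • e + Real.sin φ • cross n e))⟫ = 0 := by
    have hd : fderiv ℝ (fun z => ⟪u z, z - x₀⟫) (x₀ + (r * Real.cos θ) • n + (r * Real.sin θ) • (Real.cos φ • e + Real.sin φ • cross n e)) = 0 := by rw [hev.fderiv_eq, fderiv_const_apply]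
    have e1 : HasFDerivAt u (fderiv ℝ u (x₀ + (r * Real.cos θ) • n + (r * Real.sin θ) • (Real.cos φ • e + Real.sin φ • cross n e))) (x₀ + (r * Real.cos θ) • n + (r * Real.sin θ) • (Real.cos φ • e + Real.sin φ • cross n e)) := (hu.differentiable one_ne_zero _).hasFDerivAt
    have e2 : HasFDerivAt (fun z : E3 => z - x₀) (ContinuousLinearMap.id ℝ E3) (x₀ + (r * Real.cos θ) • n + (r * Real.sin θ) • (Real.cos φ • e + Real.sin φ • cross n e)) := (hasFDerivAt_id _).sub_const x₀
    have h := congrArg (fun L : E3 →L[ℝ] ℝ => L (Real.cos θ • n + Real.sin θ • (Real.cos φ • e + Real.sin φ • cross n e))) ((e1.inner ℝ e2).fderiv.symm.trans hd)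
    simp only [ContinuousLinearMap.coe_comp, Function.comp_apply, ContinuousLinearMap.prod_apply,
      fderivInnerCLM_apply, ContinuousLinearMap.coe_id', id_eq, zero_apply] at h
    rw [hsub, hy, hU0, zero_add, inner_smul_right, real_inner_comm] at h
    exact h
  refine (hasDerivAt_azimuthal_latitude hu x₀ n e r θ φ).congr_deriv ?_
  have hD := surfaceDivergence_movingFrame u (x₀ + (r * Real.cos θ) • n + (r * Real.sin θ) • (Real.cos φ • e + Real.sin φ • cross n e)) hn hρ1 hnρ r θ
  rw [hnρx, hdiv, mul_zero, hU0, hS0] at hD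
  linarith

/-! ### Joint continuity of the frame components along the latitude family -/

/-- Joint continuity of `(θ, φ) ↦ u_φ` along the latitude circles of the frame `(n, e, n × e)`. [folklore] -/
theorem continuous_latitude_uphi {u : E3 → E3} (hu : ContDiff ℝ 1 u) (x₀ n e : E3) (r : ℝ) :
    Continuous fun p : ℝ × ℝ => ⟪u (x₀ + (r * Real.cos p.1) • n + (r * Real.sin p.1) • (Real.cos p.2 • e + Real.sin p.2 • cross n e)), ((-Real.sin p.2) • e + Real.cos p.2 • cross n e)⟫ := by
  have huc : Continuous u := hu.continuous
  fun_prop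

/-- Joint continuity of `(θ, φ) ↦ u_θ` along the latitude circles of the frame `(n, e, n × e)`. [folklore] -/
theorem continuous_latitude_utheta {u : E3 → E3} (hu : ContDiff ℝ 1 u) (x₀ n e : E3) (r : ℝ) :
    Continuous fun p : ℝ × ℝ => ⟪u (x₀ + (r * Real.cos p.1) • n + (r * Real.sin p.1) • (Real.cos p.2 • e + Real.sin p.2 • cross n e)), ((-Real.sin p.1) • n + Real.cos p.1 • (Real.cos p.2 • e + Real.sin p.2 • cross n e))⟫ := by
  have huc : Continuous u := hu.continuous
  fun_prop

/-- Joint continuity of `(θ, φ) ↦ ∂_θ(sin θ·u_φ)`. [folklore] -/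
theorem continuous_latitude_dphi {u : E3 → E3} (hu : ContDiff ℝ 1 u) (x₀ n e : E3) (r : ℝ) :
    Continuous fun p : ℝ × ℝ => (Real.cos p.1 * ⟪u (x₀ + (r * Real.cos p.1) • n + (r * Real.sin p.1) • (Real.cos p.2 • e + Real.sin p.2 • cross n e)), ((-Real.sin p.2) • e + Real.cos p.2 • cross n e)⟫ + Real.sin p.1 * ⟪fderiv ℝ u (x₀ + (r * Real.cos p.1) • n + (r * Real.sin p.1) • (Real.cos p.2 • e + Real.sin p.2 • cross n e)) (r • ((-Real.sin p.1) • n + Real.cos p.1 • (Real.cos p.2 • e + Real.sin p.2 • cross n e))), ((-Real.sin p.2) • e + Real.cos p.2 • cross n e)⟫) := by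
  have huc : Continuous u := hu.continuous
  have hfd : Continuous (fderiv ℝ u) := hu.continuous_fderiv one_ne_zero
  fun_prop

/-- Joint continuity of `(θ, φ) ↦ ∂_θ(sin θ·u_θ)`. [folklore] -/
theorem continuous_latitude_dtheta {u : E3 → E3} (hu : ContDiff ℝ 1 u) (x₀ n e : E3) (r : ℝ) :
    Continuous fun p : ℝ × ℝ => (Real.cos p.1 * ⟪u (x₀ + (r * Real.cos p.1) • n + (r * Real.sin p.1) • (Real.cos p.2 • e + Real.sin p.2 • cross n e)), ((-Real.sin p.1) • n + Real.cos p.1 • (Real.cos p.2 • e + Real.sin p.2 • cross n e))⟫ + Real.sin p.1 * (⟪u (x₀ + (r * Real.cos p.1) • n + (r * Real.sin p.1) • (Real.cos p.2 • e + Real.sin p.2 • cross n e)), -(Real.cos p.1 • n + Real.sin p.1 • (Real.cos p.2 • e + Real.sin p.2 • cross n e))⟫ + ⟪fderiv ℝ u (x₀ + (r * Real.cos p.1) • n + (r * Real.sin p.1) • (Real.cos p.2 • e + Real.sin p.2 • cross n e)) (r • ((-Real.sin p.1) • n + Real.cos p.1 • (Real.cos p.2 • e + Real.sin p.2 • cross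 n e))), ((-Real.sin p.1) • n + Real.cos p.1 • (Real.cos p.2 • e + Real.sin p.2 • cross n e))⟫)) := by
  have huc : Continuous u := hu.continuous
  have hfd : Continuous (fderiv ℝ u) := hu.continuous_fderiv one_ne_zero
  fun_prop

/-! ### All latitude Fourier modes vanish -/

/-- **ALL LATITUDE FOURIER MODES OF A TANGENT, SOLENOIDAL, UNTHREADED FIELD VANISH.**  Let `u ∈ C¹(ℝ³; ℝ³)` be divergence-free,
tangent to the spheres `S_s(x₀)` for `r₁ < s < r₂` and unthreaded on `S_r(x₀)` (`r₁ < r < r₂`).  Fix a unit axis `n`, a unit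
`e ⊥ n`, the latitude circle `φ ↦ x₀ + r cos θ·n + r sin θ·ρ̂(φ)` (`ρ̂ = cos φ·e + sin φ·(n × e)`, `0 < θ < π`) with azimuthal /
meridional unit vectors `φ̂(φ) = −sin φ·e + cos φ·(n × e)`, `θ̂(φ) = −sin θ·n + cos θ·ρ̂(φ)`.  Then for every `k ≥ 1`:
`∮ cos kφ·u_φ = ∮ sin kφ·u_φ = ∮ cos kφ·u_θ = ∮ sin kφ·u_θ = 0`.
Proof: the modes obey `(sin θ A_c)′ = k B_s`, `(sin θ B_s)′ = k A_c`, `(sin θ A_s)′ = −k B_c`, `(sin θ B_c)′ = −k A_s`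
(differentiate under the integral, use `∂_θ(sin θ u_φ) = ∂_φ u_θ`, `∂_θ(sin θ u_θ) = −∂_φ u_φ`, integrate by parts); the
products `sin²θ·A_c B_s` and `−sin²θ·A_s B_c` are monotone on `[0,π]` and pinned at `0`, hence flat. [folklore] -/
theorem latitudeModes_eq_zero {u : E3 → E3} (hu : ContDiff ℝ 1 u)
    (hdiv : Literature.Analysis.FluidPDE.VectorCalculus.IsDivFree u) (x₀ : E3) {r₁ r₂ r : ℝ} (hr₁ : 0 ≤ r₁)
    (h₁ : r₁ < r) (h₂ : r < r₂)
    (htan : ∀ x : E3, r₁ < ‖x - x₀‖ → ‖x - x₀‖ < r₂ → ⟪u x, x - x₀⟫ = 0)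
    (hunthr : ∀ y : E3, ‖y‖ = r → ⟪y, curl u (x₀ + y)⟫ = 0) {n e : E3} (hn : ‖n‖ = 1) (he : ‖e‖ = 1)
    (hne : ⟪n, e⟫ = 0) {k : ℕ} (hk : k ≠ 0) {θ : ℝ} (hθ : θ ∈ Ioo 0 Real.pi) :
    (∫ φ in (0 : ℝ)..2 * Real.pi, Real.cos (k * φ) *
        ⟪u (x₀ + (r * Real.cos θ) • n + (r * Real.sin θ) • (Real.cos φ • e + Real.sin φ • cross n e)),
          (-Real.sin φ) • e + Real.cos φ • cross n e⟫) = 0 ∧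
    (∫ φ in (0 : ℝ)..2 * Real.pi, Real.sin (k * φ) *
        ⟪u (x₀ + (r * Real.cos θ) • n + (r * Real.sin θ) • (Real.cos φ • e + Real.sin φ • cross n e)),
          (-Real.sin φ) • e + Real.cos φ • cross n e⟫) = 0 ∧
    (∫ φ in (0 : ℝ)..2 * Real.pi, Real.cos (k * φ) *
        ⟪u (x₀ + (r * Real.cos θ) • n + (r * Real.sin θ) • (Real.cos φ • e + Real.sin φ • cross n e)),
          (-Real.sin θ) • n + Real.cos θ • (Real.cos φ • e + Real.sin φ • cross n e)⟫) = 0 ∧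
    (∫ φ in (0 : ℝ)..2 * Real.pi, Real.sin (k * φ) *
        ⟪u (x₀ + (r * Real.cos θ) • n + (r * Real.sin θ) • (Real.cos φ • e + Real.sin φ • cross n e)),
          (-Real.sin θ) • n + Real.cos θ • (Real.cos φ • e + Real.sin φ • cross n e)⟫) = 0 := by
  have hr : 0 < r := lt_of_le_of_lt hr₁ h₁
  have hkpos : (0 : ℝ) < k := by exact_mod_cast Nat.pos_of_ne_zero hk
  -- `θ`-derivatives of `sin θ u_φ`, `sin θ u_θ` and the Cauchy–Riemann-type system
  have hFd : ∀ t φ : ℝ, HasDerivAt (fun t : ℝ => Real.sin t * ⟪u (x₀ + (r * Real.cos t) • n + (r * Real.sin t) • (Real.cos φ • e + Real.sin φ • cross n e)), ((-Real.sin φ) • e + Real.cos φ • cross n e)⟫) (Real.cos t * ⟪u (x₀ + (r * Real.cos t) • n + (r * Real.sin t) • (Real.cos φ • e + Real.sin φ • cross n e)), ((-Real.sin φ) • e + Real.cos φ • cross n e)⟫ + Real.sin t * ⟪fderiv ℝ u (x₀ + (r * Real.cos t) • n + (r * Real.sin t) • (Real.cos φ • e + Real.sin φ • cross n e)) (r •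 ((-Real.sin t) • n + Real.cos t • (Real.cos φ • e + Real.sin φ • cross n e))), ((-Real.sin φ) • e + Real.cos φ • cross n e)⟫) t := fun t φ =>
    hasDerivAt_azimuthal_meridian hu x₀ n (Real.cos φ • e + Real.sin φ • cross n e) ((-Real.sin φ) • e + Real.cos φ • cross n e) r t
  have hGd : ∀ t φ : ℝ, HasDerivAt (fun t : ℝ => Real.sin t * ⟪u (x₀ + (r * Real.cos t) • n + (r * Real.sin t) • (Real.cos φ • e + Real.sin φ • cross n e)), ((-Real.sin t) • n + Real.cos t • (Real.cos φ • e + Real.sin φ • cross n e))⟫) (Real.cos t * ⟪u (x₀ + (r * Real.cos t) • n + (r * Real.sin t) • (Real.cos φ • e + Real.sin φ • cross n e)), ((-Real.sin t) • n + Real.cos t • (Real.cos φ • e + Real.sin φ • cross n e))⟫ + Real.sin t * (⟪u (x₀ + (r * Real.cos t) • n + (r * Real.sin t) • (Real.cos φ • e + Real.sin φ • cross n e)), -(Real.cos t • n + Real.sin t • (Real.cos φ • e + Real.sin φ • cross n e))⟫ + ⟪fderiv ℝ u (x₀ + (r * Real.cos t) • n + (r * Real.sin t) • (Real.cos φ •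 e + Real.sin φ • cross n e)) (r • ((-Real.sin t) • n + Real.cos t • (Real.cos φ • e + Real.sin φ • cross n e))), ((-Real.sin t) • n + Real.cos t • (Real.cos φ • e + Real.sin φ • cross n e))⟫)) t := fun t φ =>
    hasDerivAt_meridional_meridian hu x₀ n (Real.cos φ • e + Real.sin φ • cross n e) r t
  have hF'eq : ∀ t φ : ℝ, HasDerivAt (fun φ : ℝ => ⟪u (x₀ + (r * Real.cos t) • n + (r * Real.sin t) • (Real.cos φ • e + Real.sin φ • cross n e)), ((-Real.sin t) • n + Real.cos t • (Real.cos φ • e + Real.sin φ • cross n e))⟫) (Real.cos t * ⟪u (x₀ + (r * Real.cos t) • n + (r * Real.sin t) • (Real.cos φ • e + Real.sin φ • cross n e)), ((-Real.sin φ) • e + Real.cos φ • cross n e)⟫ + Real.sin t * ⟪fderiv ℝ u (x₀ + (r * Real.cos t) • n + (r * Real.sin t) • (Real.cos φ • e + Real.sin φ • cross n e)) (r • ((-Real.sin t) • n + Real.cos t • (Real.cos φ • e + Real.sin φ • cross n e))), ((-Real.sin φ) • e + Real.cos φ • cross n e)⟫) φ := fun t φ =>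
    latitude_CR_of_unthreaded hu x₀ hr hunthr hn he hne t φ
  have hG'eq : ∀ t φ : ℝ, HasDerivAt (fun φ : ℝ => ⟪u (x₀ + (r * Real.cos t) • n + (r * Real.sin t) • (Real.cos φ • e + Real.sin φ • cross n e)), ((-Real.sin φ) • e + Real.cos φ • cross n e)⟫) (-(Real.cos t * ⟪u (x₀ + (r * Real.cos t) • n + (r * Real.sin t) • (Real.cos φ • e + Real.sin φ • cross n e)), ((-Real.sin t) • n + Real.cos t • (Real.cos φ • e + Real.sin φ • cross n e))⟫ + Real.sin t * (⟪u (x₀ + (r * Real.cos t) • n + (r * Real.sin t) • (Real.cos φ • e + Real.sin φ • cross n e)), -(Real.cos t • n + Real.sin t • (Real.cos φ • e + Real.sin φ • cross n e))⟫ + ⟪fderiv ℝ u (x₀ + (r * Real.cos t) • n + (r * Real.sin t) • (Real.cos φ • e + Real.sin φ • cross n e)) (r • ((-Real.sin t) • n + Real.cos t • (Real.cos φ • e + Real.sin φ • cross n e))), ((-Real.sin t) • n + Real.cos t • (Real.cos φ • e + Real.sin φ • cross n e))⟫))) φ := fun t φ =>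
    latitude_CR_of_tangent_divFree hu hdiv x₀ hr₁ h₁ h₂ htan hn he hne t φ
  -- continuity and periodicity
  have hUφc := continuous_latitude_uphi hu x₀ n e r
  have hUθc := continuous_latitude_utheta hu x₀ n e r
  have hFc := continuous_latitude_dphi hu x₀ n e r
  have hGc := continuous_latitude_dtheta hu x₀ n e r
  have hcw : Continuous fun p : ℝ × ℝ => Real.cos (k * p.2) := by fun_prop
  have hsw : Continuous fun p : ℝ × ℝ => Real.sin (k * p.2) := by fun_prop
  have hs1 : Continuous fun p : ℝ × ℝ => Real.sin p.1 := Real.continuous_sin.comp continuous_fst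
  have hsec : ∀ t : ℝ, Continuous fun φ : ℝ => (t, φ) := fun t => continuous_const.prodMk continuous_id
  have hFcθ : ∀ t : ℝ, Continuous fun φ : ℝ => (Real.cos t * ⟪u (x₀ + (r * Real.cos t) • n + (r * Real.sin t) • (Real.cos φ • e + Real.sin φ • cross n e)), ((-Real.sin φ) • e + Real.cos φ • cross n e)⟫ + Real.sin t * ⟪fderiv ℝ u (x₀ + (r * Real.cos t) • n + (r * Real.sin t) • (Real.cos φ • e + Real.sin φ • cross n e)) (r • ((-Real.sin t) • n + Real.cos t • (Real.cos φ • e + Real.sin φ • cross n e))), ((-Real.sin φ) • e + Real.cos φ • cross n e)⟫) := fun t => hFc.comp (hsec t)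
  have hGcθ : ∀ t : ℝ, Continuous fun φ : ℝ => -(Real.cos t * ⟪u (x₀ + (r * Real.cos t) • n + (r * Real.sin t) • (Real.cos φ • e + Real.sin φ • cross n e)), ((-Real.sin t) • n + Real.cos t • (Real.cos φ • e + Real.sin φ • cross n e))⟫ + Real.sin t * (⟪u (x₀ + (r * Real.cos t) • n + (r * Real.sin t) • (Real.cos φ • e + Real.sin φ • cross n e)), -(Real.cos t • n + Real.sin t • (Real.cos φ • e + Real.sin φ • cross n e))⟫ + ⟪fderiv ℝ u (x₀ + (r * Real.cos t) • n + (r * Real.sin t) • (Real.cos φ • e + Real.sin φ • cross n e)) (r • ((-Real.sin t) • n + Real.cos t • (Real.cos φ • e + Real.sin φ • cross n e))), ((-Real.sin t) • n + Real.cos t • (Real.cos φ • e + Real.sin φ • cross n e))⟫)) := fun t => (hGc.comp (hsec t)).neg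
  have hperθ : ∀ t : ℝ, (fun φ : ℝ => ⟪u (x₀ + (r * Real.cos t) • n + (r * Real.sin t) • (Real.cos φ • e + Real.sin φ • cross n e)), ((-Real.sin t) • n + Real.cos t • (Real.cos φ • e + Real.sin φ • cross n e))⟫) (2 * Real.pi) = (fun φ : ℝ => ⟪u (x₀ + (r * Real.cos t) • n + (r * Real.sin t) • (Real.cos φ • e + Real.sin φ • cross n e)), ((-Real.sin t) • n + Real.cos t • (Real.cos φ • e + Real.sin φ • cross n e))⟫) 0 := fun t => by
    simp only [Real.cos_two_pi, Real.sin_two_pi, Real.cos_zero, Real.sin_zero]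
  have hperφ : ∀ t : ℝ, (fun φ : ℝ => ⟪u (x₀ + (r * Real.cos t) • n + (r * Real.sin t) • (Real.cos φ • e + Real.sin φ • cross n e)), ((-Real.sin φ) • e + Real.cos φ • cross n e)⟫) (2 * Real.pi) = (fun φ : ℝ => ⟪u (x₀ + (r * Real.cos t) • n + (r * Real.sin t) • (Real.cos φ • e + Real.sin φ • cross n e)), ((-Real.sin φ) • e + Real.cos φ • cross n e)⟫) 0 := fun t => by
    simp only [Real.cos_two_pi, Real.sin_two_pi, Real.cos_zero, Real.sin_zero]
  -- the four modes as functions of the colatitude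
  obtain ⟨Ac, hAc⟩ : ∃ Ac : ℝ → ℝ, ∀ t, Ac t = ∫ φ in (0 : ℝ)..2 * Real.pi, Real.cos (k * φ) * ⟪u (x₀ + (r * Real.cos t) • n + (r * Real.sin t) • (Real.cos φ • e + Real.sin φ • cross n e)), ((-Real.sin φ) • e + Real.cos φ • cross n e)⟫ := ⟨_, fun t => rfl⟩
  obtain ⟨As, hAs⟩ : ∃ As : ℝ → ℝ, ∀ t, As t = ∫ φ in (0 : ℝ)..2 * Real.pi, Real.sin (k * φ) * ⟪u (x₀ + (r * Real.cos t) • n + (r * Real.sin t) • (Real.cos φ • e + Real.sin φ • cross n e)), ((-Real.sin φ) • e + Real.cos φ • cross n e)⟫ := ⟨_, fun t => rfl⟩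
  obtain ⟨Bc, hBc⟩ : ∃ Bc : ℝ → ℝ, ∀ t, Bc t = ∫ φ in (0 : ℝ)..2 * Real.pi, Real.cos (k * φ) * ⟪u (x₀ + (r * Real.cos t) • n + (r * Real.sin t) • (Real.cos φ • e + Real.sin φ • cross n e)), ((-Real.sin t) • n + Real.cos t • (Real.cos φ • e + Real.sin φ • cross n e))⟫ := ⟨_, fun t => rfl⟩
  obtain ⟨Bs, hBs⟩ : ∃ Bs : ℝ → ℝ, ∀ t, Bs t = ∫ φ in (0 : ℝ)..2 * Real.pi, Real.sin (k * φ) * ⟪u (x₀ + (r * Real.cos t) • n + (r * Real.sin t) • (Real.cos φ • e + Real.sin φ • cross n e)), ((-Real.sin t) • n + Real.cos t • (Real.cos φ • e + Real.sin φ • cross n e))⟫ := ⟨_, fun t => rfl⟩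
  -- `(sin θ A_c)′ = k B_s`
  have hXd : ∀ t, HasDerivAt (fun t => Real.sin t * Ac t) (k * Bs t) t := by
    intro t
    have h := hasDerivAt_intervalIntegral_of_continuous
      (F := fun t φ => Real.cos (k * φ) * (Real.sin t * ⟪u (x₀ + (r * Real.cos t) • n + (r * Real.sin t) • (Real.cos φ • e + Real.sin φ • cross n e)), ((-Real.sin φ) • e + Real.cos φ • cross n e)⟫))
      (F' := fun t φ => Real.cos (k * φ) * (Real.cos t * ⟪u (x₀ + (r * Real.cos t) • n + (r * Real.sin t) • (Real.cos φ • e + Real.sin φ • cross n e)), ((-Real.sin φ) • e + Real.cos φ • cross n e)⟫ + Real.sin t * ⟪fderiv ℝ u (x₀ + (r * Real.cos t) • n + (r * Real.sin t) • (Real.cos φ • e + Real.sin φ • cross n e)) (r • ((-Real.sin t) • n + Real.cos t • (Real.cos φ • e + Real.sin φ • cross n e))), ((-Real.sin φ) • e + Real.cos φ • cross n e)⟫)) (hcw.mul (hs1.mul hUφc)) (hcw.mul hFc)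
      (fun t φ => (hFd t φ).const_mul _) t
    have hfun : (fun t : ℝ => Real.sin t * Ac t) = fun t => ∫ φ in (0 : ℝ)..2 * Real.pi, Real.cos (k * φ) * (Real.sin t * ⟪u (x₀ + (r * Real.cos t) • n + (r * Real.sin t) • (Real.cos φ • e + Real.sin φ • cross n e)), ((-Real.sin φ) • e + Real.cos φ • cross n e)⟫) := by
      funext t; rw [hAc t, ← intervalIntegral.integral_const_mul]; congr 1; funext φ; ring
    rw [hfun]
    refine h.congr_deriv ?_
    rw [hBs t]
    exact integral_cos_mul_deriv_periodic (hF'eq t) (hFcθ t) (hperθ t) k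
  -- `(sin θ B_s)′ = k A_c`
  have hYd : ∀ t, HasDerivAt (fun t => Real.sin t * Bs t) (k * Ac t) t := by
    intro t
    have h := hasDerivAt_intervalIntegral_of_continuous
      (F := fun t φ => Real.sin (k * φ) * (Real.sin t * ⟪u (x₀ + (r * Real.cos t) • n + (r * Real.sin t) • (Real.cos φ • e + Real.sin φ • cross n e)), ((-Real.sin t) • n + Real.cos t • (Real.cos φ • e + Real.sin φ • cross n e))⟫))
      (F' := fun t φ => Real.sin (k * φ) * (Real.cos t * ⟪u (x₀ + (r * Real.cos t) • n + (r * Real.sin t) • (Real.cos φ • e + Real.sin φ • cross n e)), ((-Real.sin t) • n + Real.cos t • (Real.cos φ • e + Real.sin φ • cross n e))⟫ + Real.sin t * (⟪u (x₀ + (r * Real.cos t) • n + (r * Real.sin t) • (Real.cos φ • e + Real.sin φ • cross n e)), -(Real.cos t • n + Real.sin t • (Real.cos φ • e + Real.sin φ • cross n e))⟫ + ⟪fderiv ℝ u (x₀ + (r * Real.cos t) • n + (r * Real.sin t) • (Real.cos φ • e + Real.sin φ • cross n e)) (r • ((-Real.sin t) • n + Real.cos t • (Real.cos φ • e + Real.sin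 φ • cross n e))), ((-Real.sin t) • n + Real.cos t • (Real.cos φ • e + Real.sin φ • cross n e))⟫))) (hsw.mul (hs1.mul hUθc)) (hsw.mul hGc)
      (fun t φ => (hGd t φ).const_mul _) t
    have hfun : (fun t : ℝ => Real.sin t * Bs t) = fun t => ∫ φ in (0 : ℝ)..2 * Real.pi, Real.sin (k * φ) * (Real.sin t * ⟪u (x₀ + (r * Real.cos t) • n + (r * Real.sin t) • (Real.cos φ • e + Real.sin φ • cross n e)), ((-Real.sin t) • n + Real.cos t • (Real.cos φ • e + Real.sin φ • cross n e))⟫) := by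
      funext t; rw [hBs t, ← intervalIntegral.integral_const_mul]; congr 1; funext φ; ring
    rw [hfun]
    refine h.congr_deriv ?_
    have hibp := integral_sin_mul_deriv_periodic (hG'eq t) (hGcθ t) (hperφ t) k
    rw [hAc t]
    have hneg : (∫ φ in (0 : ℝ)..2 * Real.pi, Real.sin (k * φ) * (Real.cos t * ⟪u (x₀ + (r * Real.cos t) • n + (r * Real.sin t) • (Real.cos φ • e + Real.sin φ • cross n e)), ((-Real.sin t) • n + Real.cos t • (Real.cos φ • e + Real.sin φ • cross n e))⟫ + Real.sin t * (⟪u (x₀ + (r * Real.cos t) • n + (r * Real.sin t) • (Real.cos φ • e + Real.sin φ • cross n e)), -(Real.cos t • n + Real.sin t • (Real.cos φ • e + Real.sin φ • cross n e))⟫ + ⟪fderiv ℝ u (x₀ + (r * Real.cos t) • n + (r * Real.sin t) • (Real.cos φ • e + Real.sin φ • cross n e)) (r • ((-Real.sin t) • n + Real.cos t • (Real.cos φ • e + Real.sin φ • cross n e))), ((-Real.sin t) • n + Real.cos t • (Real.cos φ • e + Real.sin φ • cross n e))⟫)))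
        = -(∫ φ in (0 : ℝ)..2 * Real.pi, Real.sin (k * φ) * -(Real.cos t * ⟪u (x₀ + (r * Real.cos t) • n + (r * Real.sin t) • (Real.cos φ • e + Real.sin φ • cross n e)), ((-Real.sin t) • n + Real.cos t • (Real.cos φ • e + Real.sin φ • cross n e))⟫ + Real.sin t * (⟪u (x₀ + (r * Real.cos t) • n + (r * Real.sin t) • (Real.cos φ • e + Real.sin φ • cross n e)), -(Real.cos t • n + Real.sin t • (Real.cos φ • e + Real.sin φ • cross n e))⟫ + ⟪fderiv ℝ u (x₀ + (r * Real.cos t) • n + (r * Real.sin t) • (Real.cos φ • e + Real.sin φ • cross n e)) (r • ((-Real.sin t) • n + Real.cos t • (Real.cos φ • e + Real.sin φ • cross n e))), ((-Real.sin t) • n + Real.cos t • (Real.cos φ • e + Real.sin φ • cross n e))⟫))) := by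
      rw [← intervalIntegral.integral_neg]; congr 1; funext φ; ring
    rw [hneg, hibp]
    ring
  -- `(sin θ A_s)′ = −k B_c`
  have hX'd : ∀ t, HasDerivAt (fun t => Real.sin t * As t) (-(k * Bc t)) t := by
    intro t
    have h := hasDerivAt_intervalIntegral_of_continuous
      (F := fun t φ => Real.sin (k * φ) * (Real.sin t * ⟪u (x₀ + (r * Real.cos t) • n + (r * Real.sin t) • (Real.cos φ • e + Real.sin φ • cross n e)), ((-Real.sin φ) • e + Real.cos φ • cross n e)⟫))
      (F' := fun t φ => Real.sin (k * φ) * (Real.cos t * ⟪u (x₀ + (r * Real.cos t) • n + (r * Real.sin t) • (Real.cos φ • e + Real.sin φ • cross n e)), ((-Real.sin φ) • e + Real.cos φ • cross n e)⟫ + Real.sin t * ⟪fderiv ℝ u (x₀ + (r * Real.cos t) • n + (r * Real.sin t) • (Real.cos φ • e + Real.sin φ • cross n e)) (r • ((-Real.sin t) • n + Real.cos t • (Real.cos φ • e + Real.sin φ • cross n e))), ((-Real.sin φ) • e + Real.cos φ • cross n e)⟫)) (hsw.mul (hs1.mul hUφc)) (hsw.mul hFc)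
      (fun t φ => (hFd t φ).const_mul _) t
    have hfun : (fun t : ℝ => Real.sin t * As t) = fun t => ∫ φ in (0 : ℝ)..2 * Real.pi, Real.sin (k * φ) * (Real.sin t * ⟪u (x₀ + (r * Real.cos t) • n + (r * Real.sin t) • (Real.cos φ • e + Real.sin φ • cross n e)), ((-Real.sin φ) • e + Real.cos φ • cross n e)⟫) := by
      funext t; rw [hAs t, ← intervalIntegral.integral_const_mul]; congr 1; funext φ; ring
    rw [hfun]
    refine h.congr_deriv ?_
    rw [hBc t]
    exact integral_sin_mul_deriv_periodic (hF'eq t) (hFcθ t) (hperθ t) k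
  -- `(sin θ B_c)′ = −k A_s`
  have hY'd : ∀ t, HasDerivAt (fun t => Real.sin t * Bc t) (-(k * As t)) t := by
    intro t
    have h := hasDerivAt_intervalIntegral_of_continuous
      (F := fun t φ => Real.cos (k * φ) * (Real.sin t * ⟪u (x₀ + (r * Real.cos t) • n + (r * Real.sin t) • (Real.cos φ • e + Real.sin φ • cross n e)), ((-Real.sin t) • n + Real.cos t • (Real.cos φ • e + Real.sin φ • cross n e))⟫))
      (F' := fun t φ => Real.cos (k * φ) * (Real.cos t * ⟪u (x₀ + (r * Real.cos t) • n + (r * Real.sin t) • (Real.cos φ • e + Real.sin φ • cross n e)), ((-Real.sin t) • n + Real.cos t • (Real.cos φ • e + Real.sin φ • cross n e))⟫ + Real.sin t * (⟪u (x₀ + (r * Real.cos t) • n + (r * Real.sin t) • (Real.cos φ • e + Real.sin φ • cross n e)), -(Real.cos t • n + Real.sin t • (Real.cos φ • e + Real.sin φ • cross n e))⟫ + ⟪fderiv ℝ u (x₀ + (r * Real.cos t) • n + (r * Real.sin t) • (Real.cos φ • e + Real.sin φ • cross n e)) (r • ((-Real.sin t) • n + Real.cos t • (Real.cos φ • e +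 Real.sin φ • cross n e))), ((-Real.sin t) • n + Real.cos t • (Real.cos φ • e + Real.sin φ • cross n e))⟫))) (hcw.mul (hs1.mul hUθc)) (hcw.mul hGc)
      (fun t φ => (hGd t φ).const_mul _) t
    have hfun : (fun t : ℝ => Real.sin t * Bc t) = fun t => ∫ φ in (0 : ℝ)..2 * Real.pi, Real.cos (k * φ) * (Real.sin t * ⟪u (x₀ + (r * Real.cos t) • n + (r * Real.sin t) • (Real.cos φ • e + Real.sin φ • cross n e)), ((-Real.sin t) • n + Real.cos t • (Real.cos φ • e + Real.sin φ • cross n e))⟫) := by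
      funext t; rw [hBc t, ← intervalIntegral.integral_const_mul]; congr 1; funext φ; ring
    rw [hfun]
    refine h.congr_deriv ?_
    have hibp := integral_cos_mul_deriv_periodic (hG'eq t) (hGcθ t) (hperφ t) k
    rw [hAs t]
    have hneg : (∫ φ in (0 : ℝ)..2 * Real.pi, Real.cos (k * φ) * (Real.cos t * ⟪u (x₀ + (r * Real.cos t) • n + (r * Real.sin t) • (Real.cos φ • e + Real.sin φ • cross n e)), ((-Real.sin t) • n + Real.cos t • (Real.cos φ • e + Real.sin φ • cross n e))⟫ + Real.sin t * (⟪u (x₀ + (r * Real.cos t) • n + (r * Real.sin t) • (Real.cos φ • e + Real.sin φ • cross n e)), -(Real.cos t • n + Real.sin t • (Real.cos φ • e + Real.sin φ • cross n e))⟫ + ⟪fderiv ℝ u (x₀ + (r * Real.cos t) • n + (r * Real.sin t) • (Real.cos φ • e + Real.sin φ • cross n e)) (r • ((-Real.sin t) • n + Real.cos t • (Real.cos φ • e + Real.sin φ • cross n e))), ((-Real.sin t) • n + Real.cos t • (Real.cos φ • e + Real.sin φ • cross n e))⟫)))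
        = -(∫ φ in (0 : ℝ)..2 * Real.pi, Real.cos (k * φ) * -(Real.cos t * ⟪u (x₀ + (r * Real.cos t) • n + (r * Real.sin t) • (Real.cos φ • e + Real.sin φ • cross n e)), ((-Real.sin t) • n + Real.cos t • (Real.cos φ • e + Real.sin φ • cross n e))⟫ + Real.sin t * (⟪u (x₀ + (r * Real.cos t) • n + (r * Real.sin t) • (Real.cos φ • e + Real.sin φ • cross n e)), -(Real.cos t • n + Real.sin t • (Real.cos φ • e + Real.sin φ • cross n e))⟫ + ⟪fderiv ℝ u (x₀ + (r * Real.cos t) • n + (r * Real.sin t) • (Real.cos φ • e + Real.sin φ • cross n e)) (r • ((-Real.sin t) • n + Real.cos t • (Real.cos φ • e + Real.sin φ • cross n e))), ((-Real.sin t) • n + Real.cos t • (Real.cos φ • e + Real.sin φ • cross n e))⟫))) := by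
      rw [← intervalIntegral.integral_neg]; congr 1; funext φ; ring
    rw [hneg, hibp]
  -- the pinned monotone products
  have hZ : ∀ t, HasDerivAt (fun t => (Real.sin t * Ac t) * (Real.sin t * Bs t))
      (k * Real.sin t * (Bs t ^ 2 + Ac t ^ 2)) t := fun t =>
    ((hXd t).mul (hYd t)).congr_deriv (by ring)
  have hZ' : ∀ t, HasDerivAt (fun t => -((Real.sin t * As t) * (Real.sin t * Bc t)))
      (k * Real.sin t * (Bc t ^ 2 + As t ^ 2)) t := fun t =>
    ((hX'd t).mul (hY'd t)).neg.congr_deriv (by ring)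
  have hnn : ∀ (P Q : ℝ → ℝ), ∀ t ∈ Ioo 0 Real.pi, 0 ≤ k * Real.sin t * (P t ^ 2 + Q t ^ 2) := by
    intro P Q t ht
    have hs : 0 < Real.sin t := Real.sin_pos_of_pos_of_lt_pi ht.1 ht.2
    positivity
  have e1 := deriv_eq_zero_of_monotone_pinned hZ (hnn Bs Ac) (by simp [Real.sin_zero]) (by simp [Real.sin_pi]) θ hθ
  have e2 := deriv_eq_zero_of_monotone_pinned hZ' (hnn Bc As) (by simp [Real.sin_zero]) (by simp [Real.sin_pi]) θ hθ
  have hs : 0 < Real.sin θ := Real.sin_pos_of_pos_of_lt_pi hθ.1 hθ.2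
  have hks : (k : ℝ) * Real.sin θ ≠ 0 := mul_ne_zero hkpos.ne' hs.ne'
  have f1 : Bs θ ^ 2 + Ac θ ^ 2 = 0 := by
    rcases mul_eq_zero.mp e1 with h | h
    · exact absurd h hks
    · exact h
  have f2 : Bc θ ^ 2 + As θ ^ 2 = 0 := by
    rcases mul_eq_zero.mp e2 with h | h
    · exact absurd h hks
    · exact h
  have hAc0 : Ac θ = 0 := by nlinarith [sq_nonneg (Bs θ), sq_nonneg (Ac θ)]
  have hBs0 : Bs θ = 0 := by nlinarith [sq_nonneg (Bs θ), sq_nonneg (Ac θ)]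
  have hAs0 : As θ = 0 := by nlinarith [sq_nonneg (Bc θ), sq_nonneg (As θ)]
  have hBc0 : Bc θ = 0 := by nlinarith [sq_nonneg (Bc θ), sq_nonneg (As θ)]
  rw [hAc θ] at hAc0; rw [hAs θ] at hAs0; rw [hBc θ] at hBc0; rw [hBs θ] at hBs0
  exact ⟨hAc0, hAs0, hBc0, hBs0⟩

end Summit.NavierStokesRegularity.NavierStokesRegularity.Theorems.PoloidalLiouville.FluxStarvedDipole

end
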